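import Summits.Parity.BatemanHorn.Theorems.AlmostPrimeZerosSystemMomentDeficitLinearK1Rough

/-!
# Crux `SystemMomentDeficit` (stmt-Parity-11326), line `Ideator3Sketch`: rough values in residue classes, linear case

Registered stub `stub_roughAPLower_linear` of the reshaped skeleton (lead c1): for `g ∈ ℤ[X]` of
degree `1` with positive leading coefficient, the one-sided residue-class bound RAL
`E(N_g ; n ≡ r (mod q)) ≥ (1/q) E(N_g) − C Λ(q)/(q log x)` for `x ≥ 16`, prime powers
`q ∈ PP(⌊x^{1/4}⌋)` and residues `r < q`.  No arithmetic input: `N_g ≥ 0` termwise and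
`Σ_{n ≤ x} N_g(n) ≤ 8A² x/log x` (`sum_roughCount_le_of_natDegree_eq_one`, `roughPairs_bound_le`:
a linear value `≤ A x` has a prime factor `> x` only with a cofactor `< A`), so with
`C = 16 A²` the left side is `≤ 0 ≤` the right side (`Λ(q) ≥ log 2 ≥ 1/2`).

Notation (docstrings only).  `Y = x + 1`, `E g = Y⁻¹ Σ_{0 ≤ n ≤ x} g(n)`, `PP(z)` = primes `≤ z` ∪
prime squares `≤ z`, `N_g(n) = s(g(n)⁺) − #{r' ∈ PP(x) : r' ∣ g(n)⁺ ≠ 0}`, `A = 2 Σ_j |coeff_j g|`.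
Everything is [folklore].
-/

namespace Summit.Parity.BatemanHorn.Cruxes.SystemMomentDeficit.Ideator3Sketch

open scoped BigOperators
open Finset Polynomial
open Literature.NumberTheory.Sieve
open Summit.Parity.BatemanHorn.Theorems.AlmostPrimeZeros.SystemMertens

/-- **RAL for linear polynomials** (registered stub `stub_roughAPLower_linear` of line `Ideator3Sketch`):
for `g` of degree `1` with positive leading coefficient there is `C` such that for all `x ≥ 16`, all
prime powers `q ∈ PP(⌊x^{1/4}⌋)` and all `r < q`,
`(1/q) E(N_g) − C Λ(q)/(q log x) ≤ E(N_g ; n ≡ r (mod q))`.  Here the right side is `≥ 0` and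
`E(N_g) ≤ 8A²/log x`, so `C = 16A²` works. -/
theorem stub_roughAPLower_linear :
    ∀ g : ℤ[X], g.natDegree = 1 → 0 < g.leadingCoeff →
      ∃ C : ℝ, ∀ x : ℕ, 16 ≤ x →
        ∀ q ∈ (Nat.primesLE (Nat.sqrt (Nat.sqrt x)) ∪
            ((Nat.primesLE (Nat.sqrt (Nat.sqrt x))).filter
              (fun p => p ^ 2 ≤ Nat.sqrt (Nat.sqrt x))).image (fun p => p ^ 2)),
          ∀ r : ℕ, r < q →
            1 / (q : ℝ) * ((∑ n ∈ Finset.range (x + 1),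
                (((((g.eval (n : ℤ)).toNat.factorization.sum fun _ v => min v 2) : ℕ) : ℝ) -
                (#((Nat.primesLE x ∪ ((Nat.primesLE x).filter (fun p => p ^ 2 ≤ x)).image (fun p => p ^ 2)).filter
                  (fun r' => r' ∣ (g.eval (n : ℤ)).toNat ∧ (g.eval (n : ℤ)).toNat ≠ 0)) : ℝ))) / ((x : ℝ) + 1)) -
              C * ArithmeticFunction.vonMangoldt q / ((q : ℝ) * Real.log x) ≤
            (∑ n ∈ (Finset.range (x + 1)).filter (fun n : ℕ => n % q = r),
                (((((g.eval (n : ℤ)).toNat.factorization.sum fun _ v => min v 2) : ℕ) : ℝ) -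
                (#((Nat.primesLE x ∪ ((Nat.primesLE x).filter (fun p => p ^ 2 ≤ x)).image (fun p => p ^ 2)).filter
                  (fun r' => r' ∣ (g.eval (n : ℤ)).toNat ∧ (g.eval (n : ℤ)).toNat ≠ 0)) : ℝ))) / ((x : ℝ) + 1) := by
  intro g hdeg hlc
  classical
  set A : ℕ := 2 * ∑ j ∈ range (g.natDegree + 1), (g.coeff j).natAbs with hA
  -- `A ≥ 1`: the leading coefficient is a nonzero coefficient
  have hA1 : 1 ≤ A := by
    have hlc' : 1 ≤ (g.coeff g.natDegree).natAbs := by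
      have h : g.coeff g.natDegree ≠ 0 := by
        rw [Polynomial.coeff_natDegree]; exact hlc.ne'
      exact Int.natAbs_pos.2 h
    have hmem : g.natDegree ∈ range (g.natDegree + 1) := mem_range.2 (Nat.lt_succ_self _)
    have hle : (g.coeff g.natDegree).natAbs ≤ ∑ j ∈ range (g.natDegree + 1), (g.coeff j).natAbs :=
      single_le_sum (f := fun j => (g.coeff j).natAbs) (fun _ _ => Nat.zero_le _) hmem
    omega
  refine ⟨16 * (A : ℝ) ^ 2, fun x hx q hq r _ => ?_⟩
  -- parameters
  obtain ⟨-, hq2, hqy⟩ := isPrimePow_and_le_of_mem_PP hq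
  have hx1 : 1 ≤ x := by omega
  have hY0 : (0 : ℝ) < (x : ℝ) + 1 := by positivity
  have hq0 : (0 : ℝ) < q := by exact_mod_cast (show 0 < q by omega)
  have hxR : (16 : ℝ) ≤ x := by exact_mod_cast hx
  have hlogx : 0 < Real.log x := Real.log_pos (by linarith)
  -- `Λ(q) ≥ 1/2` for a prime power `q ≥ 2`
  have hΛ : (1 : ℝ) / 2 ≤ ArithmeticFunction.vonMangoldt q := by
    obtain ⟨p, a, hp, ha, rfl⟩ := (isPrimePow_nat_iff q).1 (isPrimePow_and_le_of_mem_PP hq).1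
    rw [ArithmeticFunction.vonMangoldt_apply_pow (by omega), ArithmeticFunction.vonMangoldt_apply_prime hp]
    have h2 : Real.log 2 ≤ Real.log p := Real.log_le_log (by norm_num) (by exact_mod_cast hp.two_le)
    have := Real.log_two_gt_d9
    linarith
  -- the summand `N_g(n) ≥ 0`
  set Ng : ℕ → ℝ := fun n =>
    ((((g.eval (n : ℤ)).toNat.factorization.sum fun _ v => min v 2) : ℕ) : ℝ) -
      (#((Nat.primesLE x ∪ ((Nat.primesLE x).filter (fun p => p ^ 2 ≤ x)).image (fun p => p ^ 2)).filter
        (fun r' => r' ∣ (g.eval (n : ℤ)).toNat ∧ (g.eval (n : ℤ)).toNat ≠ 0)) : ℝ) with hNg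
  have hNg0 : ∀ n, 0 ≤ Ng n := fun n => by
    simp only [hNg, sub_nonneg]
    exact_mod_cast card_PP_filter_le_capped x _
  -- `Σ_{n ≤ x} N_g(n) ≤ 8A² x/log x`
  have hsum : ∑ n ∈ range (x + 1), Ng n ≤ 8 * (A : ℝ) ^ 2 * x / Real.log x := by
    have h1 := sum_roughCount_le_of_natDegree_eq_one g hdeg hlc x hx1
    have h2 := roughPairs_bound_le (x := x) hA1 hx
    -- the natural-number subtraction is exact termwise
    have hcast : ∀ n, Ng n = ((((((g.eval (n : ℤ)).toNat.factorization.sum fun _ v => min v 2) : ℕ) -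
        #((Nat.primesLE x ∪ ((Nat.primesLE x).filter (fun p => p ^ 2 ≤ x)).image (fun p => p ^ 2)).filter
          (fun r' => r' ∣ (g.eval (n : ℤ)).toNat ∧ (g.eval (n : ℤ)).toNat ≠ 0)) : ℕ) : ℝ)) := by
      intro n
      rw [hNg, Nat.cast_sub (card_PP_filter_le_capped x _)]
    have h3 : ∑ n ∈ range (x + 1), Ng n =
        (((∑ n ∈ range (x + 1), ((((g.eval (n : ℤ)).toNat.factorization.sum fun _ v => min v 2) : ℕ) -
          #((Nat.primesLE x ∪ ((Nat.primesLE x).filter (fun p => p ^ 2 ≤ x)).image (fun p => p ^ 2)).filter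
            (fun r' => r' ∣ (g.eval (n : ℤ)).toNat ∧ (g.eval (n : ℤ)).toNat ≠ 0))) : ℕ) : ℝ)) := by
      rw [Nat.cast_sum]
      exact sum_congr rfl fun n _ => hcast n
    rw [h3]
    calc _ ≤ ((A * (Nat.primeCounting (A * x) + (Nat.sqrt (A * x) + 1)) : ℕ) : ℝ) := by
          rw [hA]; exact_mod_cast h1
      _ ≤ 8 * (A : ℝ) ^ 2 * x / Real.log x := h2
  -- the right side is `≥ 0`
  have hR0 : 0 ≤ (∑ n ∈ (range (x + 1)).filter (fun n : ℕ => n % q = r), Ng n) / ((x : ℝ) + 1) :=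
    div_nonneg (sum_nonneg fun n _ => hNg0 n) hY0.le
  -- the left side is `≤ 0`
  have hL : 1 / (q : ℝ) * ((∑ n ∈ range (x + 1), Ng n) / ((x : ℝ) + 1)) -
      16 * (A : ℝ) ^ 2 * ArithmeticFunction.vonMangoldt q / ((q : ℝ) * Real.log x) ≤ 0 := by
    have h1 : (∑ n ∈ range (x + 1), Ng n) / ((x : ℝ) + 1) ≤ 8 * (A : ℝ) ^ 2 / Real.log x := by
      rw [div_le_iff₀ hY0]
      refine hsum.trans ?_
      rw [div_mul_eq_mul_div, div_le_div_iff_of_pos_right hlogx]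
      have : (0 : ℝ) ≤ 8 * (A : ℝ) ^ 2 := by positivity
      nlinarith
    have h2 : 1 / (q : ℝ) * ((∑ n ∈ range (x + 1), Ng n) / ((x : ℝ) + 1)) ≤
        1 / (q : ℝ) * (8 * (A : ℝ) ^ 2 / Real.log x) :=
      mul_le_mul_of_nonneg_left h1 (by positivity)
    have h3 : 1 / (q : ℝ) * (8 * (A : ℝ) ^ 2 / Real.log x) ≤
        16 * (A : ℝ) ^ 2 * ArithmeticFunction.vonMangoldt q / ((q : ℝ) * Real.log x) := by
      rw [div_mul_div_comm, one_mul, div_le_div_iff_of_pos_right (by positivity)]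
      have : (0 : ℝ) ≤ (A : ℝ) ^ 2 := by positivity
      nlinarith
    linarith
  simp only [hNg] at hR0 hL
  linarith

end Summit.Parity.BatemanHorn.Cruxes.SystemMomentDeficit.Ideator3Sketch
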